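import Mathlib
import Literature.MathematicalPhysics.QuantumFieldTheory.Balaban1983to89.Beta.EffectiveKernel

/-!
# Beta / ScaleTransport — the two conditional-covariance decompositions behind Bałaban's B4 (3.6)
(in the cell's derived specialisation (3.6)₀: `Λ = Ω^{(k)}`, `m_k = 0`, `A = 0`, torus):
`C^{(k)} = N⁻¹ + N⁻¹ a Q · 𝒢_k · a Q* N⁻¹` (φ-first) and `𝒢_k = G_k + G_k Q* a · C^{(k)} · a Q G_k`
(ψ-first), `𝒢_k = (−Δ^η + a_{k+1}L⁻²P_{k+1})⁻¹`, as kernel-checked identities of abstract matrices  (v1.1, docfix G-beta-20)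

HONEST FRAMING (verbatim, page 1 of everything this cell writes): discharging `BetaPertH` makes Bałaban's UV
stability UNCONDITIONAL — a real constructive-QFT result; it is NOT the continuum limit and NOT the Clay problem.
THIS MODULE discharges nothing of that.  It is a Mathlib-elementary certificate ([folklore] Gaussian / Schur-complement
algebra over an arbitrary commutative ring); nothing printed by Bałaban is asserted, no hypothesis is a quotation, and
no analytic bound (decay, uniformity in `k`, `L` or the volume) is claimed.

WHY (cell context; unit `b2b-balaban-beta-an1-g4`; v1.1 = DOCSTRING-ONLY fix by unit `b2b-balaban-beta-an1-g9` answering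
referee GAPS G-beta-20 — every declaration, statement and proof below is byte-identical to v1; β sub-cell of `pub-balaban`,
GAPS row G-sb12-4 = the (W3a) input of `Beta/WindowInterface.windowDecomposition_of_legSplitInterface`).  The (W3a)
object is the one-step fluctuation covariance `Γ_{L,k} = C^{(k)} = (Δ^{(k)} + a L⁻² P_L)⁻¹` — [Balaban1983RegularityDecay]
(B4, CMP 89) p. 573 (1.13) «C^{(k)}_Λ(Ω,A) = ((Δ^{(k)}(Ω,A) + aL⁻²P(A))|_Λ)⁻¹» (with «X|_Λ = ΛXΛ, where Λ also denotes
the characteristic function of the set Λ»), (1.14) «Δ^{(k)}(Ω,A) = a_kI − a_k²Q_k(A)G_k(Ω,A)Q_k*(A)», «where a_k is a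
constant proportional to a», and p. 572 (1.5) «P_k(A) = Q_k*(A)Q_k(A)», (1.6) «G_k(Ω,A) = (−Δ^{η,N}_{A,Ω} + m² + aP_k(A))⁻¹»
— READ by the cell [derived specialisation] at `A = 0`, zero mass, `Ω` = the torus, `Λ = Ω^{(k)}` (all unit-lattice
variables), constraint weight `a_k` at level `k`: in the tree `Δ^{(k)}` is an5's `EffectiveKernel.pushK` (`K_eff`), and
`G_k = (−Δ^η + a_k Q_k* Q_k)⁻¹`.
WHAT BAŁABAN PRINTS IN §3 (renders of pp. 586–588 read as images by an1-g4, re-read by an1-g9 together with pp. 572–573;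
«…» = verbatim).  p. 587: «and using the recursive relation a_{k+1} = a a_k/(aL⁻² + a_k), we get» (3.4) [the explicit
Gaussian `φ`-integral, transcribed in AN1.md §16.1]; «Z is of course a normalization factor. Denoting
   G_k(Ω,Λ,A) = (−Δ^{η,N}_{A,Ω} + m_k² + a_kP_k(A)(Ω∖B^k(Λ)) + a_{k+1}L⁻²P_{k+1}(A)B^k(Λ))⁻¹ ,   (3.5)»;
p. 588: «we have finally
   C^{(k)}_Λ(Ω,A;y,y′) = ([−(a_{k+1}/a_k)L⁻²Q*(A)Q_{k+1}(A) + Q_k(A)] G_k(Ω,Λ,A)·[−(a_{k+1}/a_k)L⁻²Q*_{k+1}(A)Q(A) + Q_k*(A)])(y,y′)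
        − (a_{k+1}/a_k²)L⁻²P(A;y,y′) + δ_{y,y′}/a_k .   (3.6)»,
and, on the same page, (3.9) «G_k(Ω,Λ,A) − G^η_{k+1}(Ω,A) = G_k(Ω,Λ,A)[a_kP_k(A) − a_{k+1}L⁻²P_{k+1}(A)](Ω∖B^k(Λ))G^η_{k+1}(Ω,A)»
together with the PRINTED CAVEAT «Generally we have to expect that bounds on C^{(k)}_Λ(Ω,A) will depend on L.»
So the middle operator of the PRINTED (3.6) is `G_k(Ω,Λ,A)` of (3.5) — unit-block constraint `a_kP_k(A)` kept on
`Ω∖B^k(Λ)`, `L`-block constraint `a_{k+1}L⁻²P_{k+1}(A)` on `B^k(Λ)`, mass `m_k²` — NOT a bare next-level propagator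
(v1 of this header compressed the two into one display; G-beta-20).  [DERIVED by the cell, not printed — AN1.md §16.1:]
in the specialisation `Λ = Ω^{(k)}` (everything integrated, `Ω∖B^k(Λ) = ∅`: the `a_kP_k` term of (3.5) is absent, and the
bracket of (3.9) is restricted to the empty set, so `G_k(Ω,Λ,A) = G^η_{k+1}(Ω,A)`), `m_k = 0`, `A = 0`, `Ω` = torus,
(3.5) reads `𝒢_k := (−Δ^η + a_{k+1}L⁻²P_{k+1})⁻¹` — the level-`(k+1)` propagator written on the `η`-lattice, equal to
`L^{2−d}G_{k+1}(·/L,·/L)` after Bałaban's rescaling (AN1.md §16.1) — and (3.6) becomes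
   `C^{(k)}(y,y′) = ([Q_k − (a_{k+1}/a_k)L⁻² Q*Q_{k+1}] 𝒢_k [adjoint])(y,y′) − (a_{k+1}/a_k²)L⁻² P(y,y′) + δ_{yy′}/a_k`   (3.6)₀,
i.e. `C^{(k)} = E Cov(ψ | φ, ψ′) + Cov(E[ψ | φ, ψ′] | ψ′)` for the three-level Gaussian (fine field `φ`, unit field `ψ`,
`L`-block field `ψ′ = 0`).  The printed caveat travels with (3.6)/(3.6)₀ wherever they feed (W3a) (GAPS C-lit1g6-2,
G-beta-20): THIS MODULE ASSERTS NO BOUND — in particular nothing uniform in `L`, `k` or the volume; that is the business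
of the (W3a) consumers, not of the identity.  §1 of this file proves (3.6)₀ and its ψ-first twin (law of total
covariance) for ABSTRACT matrices, in the dictionary (glosses `↔` are the cell's, not quotations)
  `M = A + U W V` ↔ `−Δ^η + a_k Q_k* Q_k` (so `M⁻¹ = G_k`),  `W` ↔ `a_k·1`,  `B` ↔ `a L⁻² P` (the next constraint seen by `ψ`),
  `N = W + B`,  `pushK A U W V + B` ↔ `Δ^{(k)} + aL⁻²P = (C^{(k)})⁻¹`,  `W − W N⁻¹ W` ↔ `a_{k+1}L⁻² P` (series weight),
  `A + U (W − W N⁻¹ W) V` ↔ `−Δ^η + a_{k+1}L⁻² P_{k+1} = 𝒢_k⁻¹` (the specialised (3.5)).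
* §1 CORE ALGEBRA with one-sided inverse hypotheses only (`core_next_mul`, `core_fluct_mul`), then the `⁻¹`-forms:
  `nextProp_eq` : `(A + U(W − W(W+B)⁻¹W)V)⁻¹ = G + G U W (pushK + B)⁻¹ W V G` (ψ-first; `G = (A+UWV)⁻¹`),
  `isUnit_nextPrecision`, and `fluctCov_eq` : `(pushK A U W V + B)⁻¹ = N⁻¹ + N⁻¹ W V (A + U(W − WN⁻¹W)V)⁻¹ U W N⁻¹`
  (φ-first = the abstract (3.6)₀).
* §2 SCALAR WEIGHTS over a field: for an idempotent `P` the local factors are explicit —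
  `(a•1 + b•P)⁻¹ = a⁻¹•1 − (b/(a(a+b)))•P` (`inv_smul_one_add_smul_proj`), the series weight
  `a•1 − (a•1)(a•1 + b•P)⁻¹(a•1) = (ab/(a+b))•P` (`seriesWeight_eq`), and Bałaban's recursion in the variable `q = L⁻²`:
  `a·a_k/(a q + a_k) = a(1−q)/(1−q^{k+1})` for `a_k = a(1−q)/(1−q^k)` (`aStep_closedForm`) — so `ab/(a+b)` with
  `(a,b) ↦ (a_k, a q)` is `a_{k+1} q` (`seriesCoeff_eq`), the coefficient of `P_{k+1}` in `G^η_{k+1}`.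
* §3 THE IDENTITY IN BAŁABAN'S LETTERS: `fluctCov_balaban` ((3.6)₀ with `W = a•1`, `B = b•P`, next-level precision
  `A + U((ab/(a+b))•P)V`), `nextProp_balaban` (its ψ-first twin), `isUnit_nextPrecision_balaban` — hypotheses: `P` idempotent,
  `a ≠ 0`, `a + b ≠ 0`, `A + U(a•1)V` and `pushK A U (a•1) V + b•P` units (in the Gaussian application all are positive
  definite).
NOT HERE: the rescaling `𝒢_k = L^{2−d}G_{k+1}(·/L)`, the telescoped sum along `L = L₀^m` (iterate `fluctCov_eq`;
AN1.md §16.3, numerically certified there), the general-`Λ` / `m_k` / `A` form of the printed (3.6) (a reading of its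
abstract shape is recorded in AN1.md §20; the cell does not use it), and every analytic statement.  value = kernel
twin of the derived specialisation (3.6)₀ of a located printed identity; NOT summit progress.
-/

namespace Literature.MathematicalPhysics.QuantumFieldTheory.Balaban1983to89.Beta.ScaleTransport

open Literature.MathematicalPhysics.QuantumFieldTheory.Balaban1983to89.Beta.EffectiveKernel (pushK pushK_def)

/-! ## §1  The two decompositions, abstractly -/

section Core

variable {R : Type*} [CommRing R] {X Y : Type*} [Fintype X] [Fintype Y] [DecidableEq X] [DecidableEq Y]

/-- **ψ-first core identity** (law of total covariance, multiplied out).  Data: `M` (fine precision incl. the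
one-step constraint, `M G = 1`), `N` (total weight on the unit field, `Ninv N = 1`), `C` with
`(N − W V G U W) C = 1` (the fluctuation covariance).  Then `G + G U W C W V G` is a right inverse of the
next-level precision `M − U W Ninv W V`. [folklore] -/
theorem core_next_mul {M G : Matrix X X R} {U : Matrix X Y R} {V : Matrix Y X R} {W N Ninv C : Matrix Y Y R}
    (hMG : M * G = 1) (hNN : Ninv * N = 1) (hC : (N - W * V * G * U * W) * C = 1) :
    (M - U * W * Ninv * W * V) * (G + G * U * W * C * W * V * G) = 1 := by
  have hMc : ∀ Z : Matrix X X R, M * (G * Z) = Z := fun Z => by rw [← Matrix.mul_assoc, hMG, Matrix.one_mul]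
  have hNc : ∀ Z : Matrix Y Y R, Ninv * (N * Z) = Z := fun Z => by rw [← Matrix.mul_assoc, hNN, Matrix.one_mul]
  -- `C − Ninv W V G U W C = Ninv (N − W V G U W) C = Ninv`
  have key : C - Ninv * (W * (V * (G * (U * (W * C))))) = Ninv := by
    have e : Ninv * ((N - W * V * G * U * W) * C) = Ninv := by rw [hC, Matrix.mul_one]
    have e2 : Ninv * ((N - W * V * G * U * W) * C) = C - Ninv * (W * (V * (G * (U * (W * C))))) := by
      simp only [Matrix.sub_mul, Matrix.mul_sub, Matrix.mul_assoc, hNc]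
    rw [← e2, e]
  have expand : (M - U * W * Ninv * W * V) * (G + G * U * W * C * W * V * G)
      = 1 + U * (W * ((C - Ninv * (W * (V * (G * (U * (W * C)))))) * (W * (V * G))))
        - U * (W * (Ninv * (W * (V * G)))) := by
    simp only [Matrix.sub_mul, Matrix.mul_sub, Matrix.mul_add, Matrix.mul_assoc, hMc, hMG]
    abel
  rw [expand, key]
  abel

/-- **φ-first core identity** (Bałaban's B4 (3.6) arrangement, multiplied out).  Data: `G M = 1`, `N Ninv = 1`,
and `G′` a right inverse of the next-level precision `M − U W Ninv W V`.  Then `Ninv + Ninv W V G′ U W Ninv` is a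
right inverse of `N − W V G U W` (= `pushK + B`). [folklore] -/
theorem core_fluct_mul {M G G' : Matrix X X R} {U : Matrix X Y R} {V : Matrix Y X R} {W N Ninv : Matrix Y Y R}
    (hGM : G * M = 1) (hNN : N * Ninv = 1) (hG' : (M - U * W * Ninv * W * V) * G' = 1) :
    (N - W * V * G * U * W) * (Ninv + Ninv * W * V * G' * U * W * Ninv) = 1 := by
  have hNc : ∀ Z : Matrix Y Y R, N * (Ninv * Z) = Z := fun Z => by rw [← Matrix.mul_assoc, hNN, Matrix.one_mul]
  -- `G′ − G U W Ninv W V G′ = G (M − U W Ninv W V) G′ = G`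
  have key : G' - G * (U * (W * (Ninv * (W * (V * G'))))) = G := by
    have e : G * ((M - U * W * Ninv * W * V) * G') = G := by rw [hG', Matrix.mul_one]
    have e2 : G * ((M - U * W * Ninv * W * V) * G') = G' - G * (U * (W * (Ninv * (W * (V * G'))))) := by
      have hGc : ∀ Z : Matrix X X R, G * (M * Z) = Z := fun Z => by rw [← Matrix.mul_assoc, hGM, Matrix.one_mul]
      simp only [Matrix.sub_mul, Matrix.mul_sub, Matrix.mul_assoc, hGc]
    rw [← e2, e]
  have expand : (N - W * V * G * U * W) * (Ninv + Ninv * W * V * G' * U * W * Ninv)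
      = 1 + W * (V * ((G' - G * (U * (W * (Ninv * (W * (V * G')))))) * (U * (W * Ninv))))
        - W * (V * (G * (U * (W * Ninv)))) := by
    simp only [Matrix.sub_mul, Matrix.mul_sub, Matrix.mul_add, Matrix.mul_assoc, hNc, hNN]
    abel
  rw [expand, key]
  abel

omit [Fintype X] [DecidableEq X] [DecidableEq Y] in
/-- the next-level ("series") weight `W − W (W+B)⁻¹ W`, inserted between `U` and `V`, is `M` minus a correction:
`A + U (W − W Ninv W) V = (A + U W V) − U W Ninv W V`. [folklore] -/
theorem nextPrecision_eq (A : Matrix X X R) (U : Matrix X Y R) (V : Matrix Y X R) (W Ninv : Matrix Y Y R) :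
    A + U * (W - W * Ninv * W) * V = (A + U * W * V) - U * W * Ninv * W * V := by
  simp only [Matrix.mul_sub, Matrix.sub_mul, Matrix.mul_assoc]
  abel

omit [DecidableEq Y] in
/-- `pushK A U W V + B = (W + B) − W V (A+UWV)⁻¹ U W`. [folklore] -/
theorem pushK_add_eq (A : Matrix X X R) (U : Matrix X Y R) (V : Matrix Y X R) (W B : Matrix Y Y R) :
    pushK A U W V + B = (W + B) - W * V * (A + U * W * V)⁻¹ * U * W := by
  rw [pushK_def]
  abel

/-- **ψ-first decomposition / the next-level propagator** (law of total covariance; one Woodbury step): if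
`M = A + U W V`, `N = W + B` and `pushK A U W V + B` are units then
`(A + U (W − W N⁻¹ W) V)⁻¹ = G + G U W (pushK + B)⁻¹ W V G`, `G = M⁻¹`.  Dictionary: `G^η_{k+1} = G_k + G_k Q_k* a_k ·
C^{(k)} · a_k Q_k G_k`. [folklore] -/
theorem nextProp_eq {A : Matrix X X R} {U : Matrix X Y R} {V : Matrix Y X R} {W B : Matrix Y Y R}
    (hM : IsUnit (A + U * W * V)) (hN : IsUnit (W + B)) (hKB : IsUnit (pushK A U W V + B)) :
    (A + U * (W - W * (W + B)⁻¹ * W) * V)⁻¹ = (A + U * W * V)⁻¹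
      + (A + U * W * V)⁻¹ * U * W * (pushK A U W V + B)⁻¹ * W * V * (A + U * W * V)⁻¹ := by
  have hMG : (A + U * W * V) * (A + U * W * V)⁻¹ = 1 :=
    Matrix.mul_nonsing_inv _ ((Matrix.isUnit_iff_isUnit_det _).mp hM)
  have hNN : (W + B)⁻¹ * (W + B) = 1 := Matrix.nonsing_inv_mul _ ((Matrix.isUnit_iff_isUnit_det _).mp hN)
  have hC : ((W + B) - W * V * (A + U * W * V)⁻¹ * U * W) * (pushK A U W V + B)⁻¹ = 1 := by
    rw [← pushK_add_eq]
    exact Matrix.mul_nonsing_inv _ ((Matrix.isUnit_iff_isUnit_det _).mp hKB)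
  rw [nextPrecision_eq]
  exact Matrix.inv_eq_right_inv (core_next_mul hMG hNN hC)

/-- the next-level precision `A + U (W − W (W+B)⁻¹ W) V` is then a unit. [folklore] -/
theorem isUnit_nextPrecision {A : Matrix X X R} {U : Matrix X Y R} {V : Matrix Y X R} {W B : Matrix Y Y R}
    (hM : IsUnit (A + U * W * V)) (hN : IsUnit (W + B)) (hKB : IsUnit (pushK A U W V + B)) :
    IsUnit (A + U * (W - W * (W + B)⁻¹ * W) * V) := by
  have hMG : (A + U * W * V) * (A + U * W * V)⁻¹ = 1 :=
    Matrix.mul_nonsing_inv _ ((Matrix.isUnit_iff_isUnit_det _).mp hM)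
  have hNN : (W + B)⁻¹ * (W + B) = 1 := Matrix.nonsing_inv_mul _ ((Matrix.isUnit_iff_isUnit_det _).mp hN)
  have hC : ((W + B) - W * V * (A + U * W * V)⁻¹ * U * W) * (pushK A U W V + B)⁻¹ = 1 := by
    rw [← pushK_add_eq]
    exact Matrix.mul_nonsing_inv _ ((Matrix.isUnit_iff_isUnit_det _).mp hKB)
  rw [nextPrecision_eq]
  exact (Matrix.isUnit_iff_isUnit_det _).mpr (Matrix.isUnit_det_of_right_inverse (core_next_mul hMG hNN hC))

/-- **φ-first decomposition = the abstract B4 (3.6)**: if `M = A + U W V`, `N = W + B` and the next-level precision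
`M′ = A + U (W − W N⁻¹ W) V` are units then
`(pushK A U W V + B)⁻¹ = N⁻¹ + N⁻¹ W V M′⁻¹ U W N⁻¹`.
Dictionary: `C^{(k)} = (a_k + aL⁻²P)⁻¹ + (a_k + aL⁻²P)⁻¹ a_k Q_k · G^η_{k+1} · Q_k* a_k (a_k + aL⁻²P)⁻¹`, and with §2
`a_k (a_k + aL⁻²P)⁻¹ = I − (a_{k+1}/a_k)L⁻²P` this is literally B4 p. 588 (3.6) at `A = 0`, `Λ = Ω` = torus. [folklore] -/
theorem fluctCov_eq {A : Matrix X X R} {U : Matrix X Y R} {V : Matrix Y X R} {W B : Matrix Y Y R}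
    (hM : IsUnit (A + U * W * V)) (hN : IsUnit (W + B)) (hM' : IsUnit (A + U * (W - W * (W + B)⁻¹ * W) * V)) :
    (pushK A U W V + B)⁻¹ = (W + B)⁻¹
      + (W + B)⁻¹ * W * V * (A + U * (W - W * (W + B)⁻¹ * W) * V)⁻¹ * U * W * (W + B)⁻¹ := by
  have hGM : (A + U * W * V)⁻¹ * (A + U * W * V) = 1 :=
    Matrix.nonsing_inv_mul _ ((Matrix.isUnit_iff_isUnit_det _).mp hM)
  have hNN : (W + B) * (W + B)⁻¹ = 1 := Matrix.mul_nonsing_inv _ ((Matrix.isUnit_iff_isUnit_det _).mp hN)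
  have hG' : ((A + U * W * V) - U * W * (W + B)⁻¹ * W * V) * (A + U * (W - W * (W + B)⁻¹ * W) * V)⁻¹ = 1 := by
    rw [← nextPrecision_eq]
    exact Matrix.mul_nonsing_inv _ ((Matrix.isUnit_iff_isUnit_det _).mp hM')
  rw [pushK_add_eq]
  exact Matrix.inv_eq_right_inv (core_fluct_mul hGM hNN hG')

/-- the same with the unit hypothesis on `pushK + B` instead of on `M′` (by `isUnit_nextPrecision`). [folklore] -/
theorem fluctCov_eq' {A : Matrix X X R} {U : Matrix X Y R} {V : Matrix Y X R} {W B : Matrix Y Y R}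
    (hM : IsUnit (A + U * W * V)) (hN : IsUnit (W + B)) (hKB : IsUnit (pushK A U W V + B)) :
    (pushK A U W V + B)⁻¹ = (W + B)⁻¹
      + (W + B)⁻¹ * W * V * (A + U * (W - W * (W + B)⁻¹ * W) * V)⁻¹ * U * W * (W + B)⁻¹ :=
  fluctCov_eq hM hN (isUnit_nextPrecision hM hN hKB)

end Core

/-! ## §2  Scalar weights: the local factors and Bałaban's recursion `a_{k+1} = a a_k/(aL⁻² + a_k)` -/

section Scalar

variable {𝕜 : Type*} [Field 𝕜] {Y : Type*} [Fintype Y] [DecidableEq Y]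

/-- for an idempotent `P` and scalars with `a ≠ 0`, `a + b ≠ 0`:
`(a•1 + b•P) (a⁻¹•1 − (b/(a(a+b)))•P) = 1`. [folklore] -/
theorem smul_one_add_smul_proj_mul {P : Matrix Y Y 𝕜} (hP : P * P = P) {a b : 𝕜} (ha : a ≠ 0)
    (hab : a + b ≠ 0) :
    (a • (1 : Matrix Y Y 𝕜) + b • P) * (a⁻¹ • (1 : Matrix Y Y 𝕜) - (b / (a * (a + b))) • P) = 1 := by
  have e : (a • (1 : Matrix Y Y 𝕜) + b • P) * (a⁻¹ • (1 : Matrix Y Y 𝕜) - (b / (a * (a + b))) • P)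
      = (1 : 𝕜) • (1 : Matrix Y Y 𝕜) + (0 : 𝕜) • P := by
    simp only [Matrix.add_mul, Matrix.mul_sub, Matrix.smul_mul, Matrix.mul_smul, Matrix.one_mul, Matrix.mul_one,
      hP, smul_add, smul_smul]
    match_scalars
    · field_simp
    · field_simp
      ring
  rw [e, one_smul, zero_smul, add_zero]

/-- **`(a•1 + b•P)⁻¹ = a⁻¹•1 − (b/(a(a+b)))•P`** for an idempotent `P`. Dictionary (`a ↦ a_k`, `b ↦ aL⁻²`,
`P ↦ P_L`): `Cov(ψ | φ, ψ′) = (a_k + aL⁻²P)⁻¹ = a_k⁻¹(I − P) + (a_k + aL⁻²)⁻¹P`. [folklore] -/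
theorem inv_smul_one_add_smul_proj {P : Matrix Y Y 𝕜} (hP : P * P = P) {a b : 𝕜} (ha : a ≠ 0)
    (hab : a + b ≠ 0) :
    (a • (1 : Matrix Y Y 𝕜) + b • P)⁻¹ = a⁻¹ • (1 : Matrix Y Y 𝕜) - (b / (a * (a + b))) • P :=
  Matrix.inv_eq_right_inv (smul_one_add_smul_proj_mul hP ha hab)

/-- the local factor of B4 (3.6): **`a (a•1 + b•P)⁻¹ = 1 − (b/(a+b))•P`** (with `a ↦ a_k`, `b ↦ aL⁻²`:
`b/(a+b) = (a_{k+1}/a_k)L⁻²`, so this is Bałaban's `I − (a_{k+1}/a_k)L⁻²P`). [folklore] -/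
theorem smul_inv_smul_one_add_smul_proj {P : Matrix Y Y 𝕜} (hP : P * P = P) {a b : 𝕜} (ha : a ≠ 0)
    (hab : a + b ≠ 0) :
    a • (a • (1 : Matrix Y Y 𝕜) + b • P)⁻¹ = (1 : 𝕜) • (1 : Matrix Y Y 𝕜) - (b / (a + b)) • P := by
  rw [inv_smul_one_add_smul_proj hP ha hab]
  simp only [smul_sub, smul_smul]
  match_scalars
  · field_simp
  · field_simp

/-- **the series weight**: `a•1 − (a•1)(a•1 + b•P)⁻¹(a•1) = (ab/(a+b))•P` for an idempotent `P` — with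
`a ↦ a_k`, `b ↦ aL⁻²` the coefficient is `a_k·aL⁻²/(a_k + aL⁻²) = a_{k+1}L⁻²`, Bałaban's weight of `P_{k+1}` in
`G^η_{k+1}` (B4 p. 587). [folklore] -/
theorem seriesWeight_eq {P : Matrix Y Y 𝕜} (hP : P * P = P) {a b : 𝕜} (ha : a ≠ 0) (hab : a + b ≠ 0) :
    a • (1 : Matrix Y Y 𝕜) - (a • (1 : Matrix Y Y 𝕜)) * (a • (1 : Matrix Y Y 𝕜) + b • P)⁻¹ * (a • (1 : Matrix Y Y 𝕜))
      = (0 : 𝕜) • (1 : Matrix Y Y 𝕜) + (a * b / (a + b)) • P := by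
  rw [inv_smul_one_add_smul_proj hP ha hab]
  simp only [Matrix.mul_sub, Matrix.smul_mul, Matrix.mul_smul, Matrix.one_mul, Matrix.mul_one,
    smul_sub, smul_smul]
  match_scalars
  · field_simp
    try ring
  · field_simp

omit [Fintype Y] [DecidableEq Y] in
/-- **Bałaban's recursion in closed form** (B4 p. 587 `a_{k+1} = a a_k/(aL⁻² + a_k)`, p. 573
`a_k = a(1−L⁻²)/(1−L^{−2k})`), in the variable `q = L⁻²`: `a·a_k/(a q + a_k) = a(1−q)/(1−q^{k+1})` for
`a_k = a(1−q)/(1−q^k)`, whenever the denominators are non-zero.  With `(a,b) ↦ (a_k, a q)` the series coefficient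
`ab/(a+b)` of `seriesWeight_eq` is therefore `q·a_{k+1} = a_{k+1}L⁻²`, the weight of `P_{k+1}` in `G^η_{k+1}`.
[folklore] -/
theorem aStep_closedForm {a q : 𝕜} (ha : a ≠ 0) {k : ℕ} (hk : 1 - q ^ k ≠ 0) (hk1 : 1 - q ^ (k + 1) ≠ 0) :
    a * (a * (1 - q) / (1 - q ^ k)) / (a * q + a * (1 - q) / (1 - q ^ k)) = a * (1 - q) / (1 - q ^ (k + 1)) := by
  have hden : a * q + a * (1 - q) / (1 - q ^ k) = a * (1 - q ^ (k + 1)) / (1 - q ^ k) := by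
    field_simp
    ring
  rw [hden]
  field_simp
  try ring

omit [Fintype Y] [DecidableEq Y] in
/-- the series coefficient with `(a,b) ↦ (a_k, a q)`: `a_k (a q)/(a_k + a q) = q · (a a_k/(a q + a_k))`. [folklore] -/
theorem seriesCoeff_eq (a q ak : 𝕜) : ak * (a * q) / (ak + a * q) = q * (a * ak / (a * q + ak)) := by
  rw [add_comm ak]
  ring

end Scalar

/-! ## §3  The identity in Bałaban's letters (scalar one-step weight `a_k`, next constraint `aL⁻² P`) -/

section Balaban

variable {𝕜 : Type*} [Field 𝕜] {X Y : Type*} [Fintype X] [Fintype Y] [DecidableEq X] [DecidableEq Y]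

omit [Fintype X] [DecidableEq X] in
/-- clean form of `seriesWeight_eq`. [folklore] -/
theorem seriesWeight_eq' {P : Matrix Y Y 𝕜} (hP : P * P = P) {a b : 𝕜} (ha : a ≠ 0) (hab : a + b ≠ 0) :
    a • (1 : Matrix Y Y 𝕜) - (a • (1 : Matrix Y Y 𝕜)) * (a • (1 : Matrix Y Y 𝕜) + b • P)⁻¹ * (a • (1 : Matrix Y Y 𝕜))
      = (a * b / (a + b)) • P := by
  rw [seriesWeight_eq hP ha hab, zero_smul, zero_add]

omit [Fintype X] [DecidableEq X] in
/-- `a•1 + b•P` is a unit for an idempotent `P`, `a ≠ 0`, `a + b ≠ 0`. [folklore] -/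
theorem isUnit_smul_one_add_smul_proj {P : Matrix Y Y 𝕜} (hP : P * P = P) {a b : 𝕜} (ha : a ≠ 0)
    (hab : a + b ≠ 0) : IsUnit (a • (1 : Matrix Y Y 𝕜) + b • P) :=
  (Matrix.isUnit_iff_isUnit_det _).mpr (Matrix.isUnit_det_of_right_inverse (smul_one_add_smul_proj_mul hP ha hab))

/-- **(3.6)₀ for abstract averaging data** (glosses `↔` are the cell's dictionary, not quotations).  Let `A` (↔ `−Δ^η`),
`U` (↔ `Q_k*`), `V` (↔ `Q_k`), an idempotent `P` (↔ `P = Q*Q`, the `L`-block averaging projection on the unit lattice)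
and scalars `a ≠ 0` (↔ `a_k`), `b` (↔ `aL⁻²`) with `a + b ≠ 0` be given, and assume `A + U (a•1) V` (↔ `G_k⁻¹`) and
`pushK A U (a•1) V + b•P` (↔ `Δ^{(k)} + aL⁻²P = (C^{(k)})⁻¹`, the cell's reading of B4 p. 573 (1.13)/(1.14)) are units.  Then
  `(pushK A U (a•1) V + b•P)⁻¹ = N⁻¹ + N⁻¹ (a•1) V · (A + U ((ab/(a+b))•P) V)⁻¹ · U (a•1) N⁻¹`,  `N = a•1 + b•P`,
where by §2 `a N⁻¹ = 1 − (b/(a+b))•P` (↔ `I − (a_{k+1}/a_k)L⁻²P`, since `b/(a+b) = aL⁻²/(a_k + aL⁻²) = (a_{k+1}/a_k)L⁻²`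
by the printed recursion p. 587 «a_{k+1} = a a_k/(aL⁻² + a_k)»), `N⁻¹ = a⁻¹•1 − (b/(a(a+b)))•P` (↔
`δ_{yy′}/a_k − (a_{k+1}/a_k²)L⁻²P(y,y′)`, the two local terms of (3.6)) and `ab/(a+b) = q·(a a_k/(a q + a_k))` (↔ `a_{k+1}L⁻²`,
`seriesCoeff_eq`, `aStep_closedForm`), so that `A + U((ab/(a+b))•P)V` ↔ `−Δ^η + a_{k+1}L⁻² Q_k* P Q_k = −Δ^η + a_{k+1}L⁻²P_{k+1}
= 𝒢_k⁻¹` — the printed p. 587 (3.5) `G_k(Ω,Λ,A)⁻¹` in the DERIVED specialisation `Λ = Ω^{(k)}`, `m_k = 0`, `A = 0` of the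
module header (there the term `a_kP_k(A)(Ω∖B^k(Λ))` of (3.5) is absent and, by the printed p. 588 (3.9),
`G_k(Ω,Λ,A) = G^η_{k+1}(Ω,A)`).  This is the kernel twin of (3.6)₀, the cell's derived specialisation of the located
printed identity [Balaban1983RegularityDecay] p. 588 (3.6) — whose middle operator AS PRINTED is `G_k(Ω,Λ,A)` of (3.5),
not a bare next-level propagator (G-beta-20).  Nothing about the size of any factor is asserted; p. 588 prints
«Generally we have to expect that bounds on C^{(k)}_Λ(Ω,A) will depend on L.» [folklore] -/
theorem fluctCov_balaban {A : Matrix X X 𝕜} {U : Matrix X Y 𝕜} {V : Matrix Y X 𝕜} {P : Matrix Y Y 𝕜}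
    (hP : P * P = P) {a b : 𝕜} (ha : a ≠ 0) (hab : a + b ≠ 0)
    (hM : IsUnit (A + U * (a • (1 : Matrix Y Y 𝕜)) * V))
    (hKB : IsUnit (pushK A U (a • (1 : Matrix Y Y 𝕜)) V + b • P)) :
    (pushK A U (a • (1 : Matrix Y Y 𝕜)) V + b • P)⁻¹ = (a • (1 : Matrix Y Y 𝕜) + b • P)⁻¹
      + (a • (1 : Matrix Y Y 𝕜) + b • P)⁻¹ * (a • (1 : Matrix Y Y 𝕜)) * V
        * (A + U * ((a * b / (a + b)) • P) * V)⁻¹ * U * (a • (1 : Matrix Y Y 𝕜)) * (a • (1 : Matrix Y Y 𝕜) + b • P)⁻¹ := by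
  have h := fluctCov_eq' hM (isUnit_smul_one_add_smul_proj hP ha hab) hKB
  rw [seriesWeight_eq' hP ha hab] at h
  exact h

/-- **the next-level propagator in Bałaban's letters** (ψ-first twin): under the same hypotheses
  `(A + U ((ab/(a+b))•P) V)⁻¹ = G + G U (a•1) · (pushK A U (a•1) V + b•P)⁻¹ · (a•1) V G`,  `G = (A + U(a•1)V)⁻¹`,
i.e. (cell's gloss) `𝒢_k = G_k + a_k² G_k Q_k* C^{(k)} Q_k G_k` — the law of total covariance
`Cov(φ|ψ′) = E Cov(φ|ψ) + Cov(E[φ|ψ] | ψ′)` for the three-level Gaussian. [folklore] -/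
theorem nextProp_balaban {A : Matrix X X 𝕜} {U : Matrix X Y 𝕜} {V : Matrix Y X 𝕜} {P : Matrix Y Y 𝕜}
    (hP : P * P = P) {a b : 𝕜} (ha : a ≠ 0) (hab : a + b ≠ 0)
    (hM : IsUnit (A + U * (a • (1 : Matrix Y Y 𝕜)) * V))
    (hKB : IsUnit (pushK A U (a • (1 : Matrix Y Y 𝕜)) V + b • P)) :
    (A + U * ((a * b / (a + b)) • P) * V)⁻¹ = (A + U * (a • (1 : Matrix Y Y 𝕜)) * V)⁻¹
      + (A + U * (a • (1 : Matrix Y Y 𝕜)) * V)⁻¹ * U * (a • (1 : Matrix Y Y 𝕜))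
        * (pushK A U (a • (1 : Matrix Y Y 𝕜)) V + b • P)⁻¹ * (a • (1 : Matrix Y Y 𝕜)) * V
        * (A + U * (a • (1 : Matrix Y Y 𝕜)) * V)⁻¹ := by
  have h := nextProp_eq hM (isUnit_smul_one_add_smul_proj hP ha hab) hKB
  rw [seriesWeight_eq' hP ha hab] at h
  exact h

/-- and the next-level precision (cell's gloss: `𝒢_k⁻¹ = −Δ^η + a_{k+1}L⁻²P_{k+1}`, the specialised (3.5)) is a unit.
[folklore] -/
theorem isUnit_nextPrecision_balaban {A : Matrix X X 𝕜} {U : Matrix X Y 𝕜} {V : Matrix Y X 𝕜}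
    {P : Matrix Y Y 𝕜} (hP : P * P = P) {a b : 𝕜} (ha : a ≠ 0) (hab : a + b ≠ 0)
    (hM : IsUnit (A + U * (a • (1 : Matrix Y Y 𝕜)) * V))
    (hKB : IsUnit (pushK A U (a • (1 : Matrix Y Y 𝕜)) V + b • P)) :
    IsUnit (A + U * ((a * b / (a + b)) • P) * V) := by
  have h := isUnit_nextPrecision hM (isUnit_smul_one_add_smul_proj hP ha hab) hKB
  rw [seriesWeight_eq' hP ha hab] at h
  exact h

end Balaban

end Literature.MathematicalPhysics.QuantumFieldTheory.Balaban1983to89.Beta.ScaleTransport
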